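import Summits.SmoothPoincare4.SmoothPoincare4.Theorems.CylinderEntropySliceIsolationConformalMapLipschitz
import Summits.SmoothPoincare4.SmoothPoincare4.Theorems.CylinderEntropySliceIsolationStubGroundStateContinuityAux
import Literature.Geometry.Riemannian.LowEntropyHypersurfacesFourProofs
import Literature.Geometry.Riemannian.ColdingMinicozziEntropyInvariance
import Literature.Geometry.Riemannian.SphericalCylinderEntropy
import Literature.Geometry.Riemannian.SphericalCylinderConformalKernel
import Mathlib
import HarnessLib

/-!
# Ground-state continuity of the conformal push-forward at unit and large scales
(stub `stub_groundStateContinuity` of line `conformal-kernel-domination`, crux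
`CylinderEntropy.SliceIsolation`, item stmt-SmoothPoincare4-7632; second of two files)

**Statement** (`stub_groundStateContinuity`, registered verbatim). For every `δ > 0` and `t₁ > 0`
there are `η > 0`, `ε > 0` such that for every measurable `A ⊆ N = {z ∈ ℝ⁶ | ∑_{i<5} zᵢ² = 1}`
separating the two ends of `N`, lying in the slab `|z₅ − t₀| ≤ η`, with
`μH⁴(A) ≤ (1 + ε) μH⁴(S⁴)`, every centre `y ∈ ℝ⁵` and every scale `t ≥ t₁ e^{2t₀}`, the Euclidean
Gaussian area of the conformal image satisfies `F_{y,t}(Φ A) ≤ λ(S⁴) + δ`, where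
`Φ(z) = e^{z₅} z'` and `λ(S⁴) = 32/(3e²)` is the Colding–Minicozzi entropy of the round sphere.

**Proof** (`gaussianArea_conformalMap_image_le_budget` + bookkeeping).
1. *Push-forward* (`CylinderEntropySliceIsolationConformalMapLipschitz`): `Φ` is
   `e^{t₀+η}`-Lipschitz on `A`, so `∫_{Φ A} w dμHE⁴ ≤ e^{4(t₀+η)} ∫_A w(Φ z) dμHE⁴(z)` for the
   Gaussian weight `w = e^{-‖· − y‖²/4t}`.
2. *Move to the slice*: `‖Φ z − e^{t₀} z'‖ = |e^{z₅} − e^{t₀}| ≤ e^{t₀}(e^{η} − 1)` on `A`, and the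
   Gaussian profile is `1/√(2t)`-Lipschitz with `1/√(2t) ≤ e^{-t₀}/√(2t₁)`; hence
   `w(Φ z) ≤ w(e^{t₀} z') + K`, `K = (e^{η} − 1)/√(2t₁)`.
3. *Shadow*: separation makes the 1-Lipschitz shadow `truncL(A)` cover `S⁴`, so
   `μHE⁴⌊S⁴ ≤ truncL_#(μHE⁴⌊A)` and
   `∫_A w(e^{t₀} z') ≤ ∫_{S⁴} w(e^{t₀} x) + (μHE⁴(A) − μHE⁴(S⁴)) ≤ ∫_{S⁴} w(e^{t₀}x) + ε μHE⁴(S⁴)`.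
4. *Main term*: `(4πt)⁻² e^{4t₀} ∫_{S⁴} w(e^{t₀} x) = F_{y,t}(e^{t₀} S⁴) ≤ λ(e^{t₀} S⁴) = λ(S⁴)`.
5. *Budget*: with `(4πt)⁻² e^{4t₀} ≤ (4πt₁)⁻²`,
   `F_{y,t}(Φ A) ≤ e^{4η} λ(S⁴) + (4πt₁)⁻² e^{4η} μHE⁴(S⁴) (ε + K(1 + ε))`, a continuous function of
   `(η, ε)` with value `λ(S⁴)` at `(0, 0)`; choose `η = ε = θ` small (`exists_budget_lt`).

Everything is proved; no definition, no named fact, no notation.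

References: T. H. Colding, W. P. Minicozzi II, Ann. of Math. 175 (2012), (0.5), (1.8), Lemma 7.2
[ColdingMinicozzi2012]; H. Federer, *Geometric Measure Theory* (1969), 2.10.11 [Federer1969].
-/

noncomputable section

-- the registered namespace `Summit.SmoothPoincare4.SmoothPoincare4.Theorems…` repeats a component
set_option linter.dupNamespace false

open MeasureTheory Set Function Filter
open scoped ENNReal NNReal Topology RealInnerProductSpace Pointwise

namespace Summit.SmoothPoincare4.SmoothPoincare4.Theorems.CylinderEntropySliceIsolation

open Literature.Geometry.Riemannian
open Literature.Geometry.Riemannian.SphericalCylinderEntropy (truncL truncL_apply lipschitz_truncL)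
open Literature.Geometry.Riemannian.SphericalCylinderConformal (gaussianNormalization_four)

/-! ## Step 2: the integrand moves to the slice -/

/-- `√(2t₁) e^{t₀} ≤ √(2t)` for `t ≥ t₁ e^{2t₀}`. [folklore] -/
theorem sqrt_mul_exp_le_sqrt {t₀ t₁ t : ℝ} (ht₁ : 0 < t₁) (ht : t₁ * Real.exp (2 * t₀) ≤ t) :
    Real.sqrt (2 * t₁) * Real.exp t₀ ≤ Real.sqrt (2 * t) := by
  have hsq : Real.exp t₀ ^ 2 = Real.exp (2 * t₀) := by
    rw [← Real.exp_nat_mul]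
    norm_num
  rw [← Real.sqrt_sq (Real.exp_pos t₀).le, ← Real.sqrt_mul (by positivity : (0 : ℝ) ≤ 2 * t₁)]
  exact Real.sqrt_le_sqrt (by nlinarith [hsq, ht, ht₁])

/-- **Pointwise comparison on `A`.** For `z ∈ N` with `|z₅ − t₀| ≤ η` and `t ≥ t₁ e^{2t₀}`:
`e^{-‖Φ z − y‖²/4t} ≤ e^{-‖e^{t₀} z' − y‖²/4t} + (e^{η} − 1)/√(2t₁)`. [folklore] -/
theorem gaussProfile_conformalMap_le {Φ : EuclideanSpace ℝ (Fin 6) → EuclideanSpace ℝ (Fin 5)}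
    (hΦ : ∀ z, Φ z = Real.exp (z 5) • truncL z) {t₀ t₁ η t : ℝ} (ht₁ : 0 < t₁)
    (ht : t₁ * Real.exp (2 * t₀) ≤ t) {z : EuclideanSpace ℝ (Fin 6)}
    (hz : ∑ i : Fin 5, z (Fin.castSucc i) ^ 2 = 1) (hzs : |z 5 - t₀| ≤ η)
    (y : EuclideanSpace ℝ (Fin 5)) :
    Real.exp (-(‖Φ z - y‖ ^ 2) / (4 * t)) ≤
      Real.exp (-(‖Real.exp t₀ • truncL z - y‖ ^ 2) / (4 * t)) +
        (Real.exp η - 1) / Real.sqrt (2 * t₁) := by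
  have htpos : 0 < t := lt_of_lt_of_le (by positivity) ht
  have hdiff : |‖Φ z - y‖ - ‖Real.exp t₀ • truncL z - y‖| ≤ Real.exp t₀ * (Real.exp η - 1) := by
    calc |‖Φ z - y‖ - ‖Real.exp t₀ • truncL z - y‖|
        ≤ ‖(Φ z - y) - (Real.exp t₀ • truncL z - y)‖ := abs_norm_sub_norm_le _ _
      _ = |Real.exp (z 5) - Real.exp t₀| := by
          rw [hΦ z, sub_sub_sub_cancel_right, ← sub_smul, norm_smul, norm_truncL_eq_one hz,
            mul_one, Real.norm_eq_abs]
      _ ≤ Real.exp t₀ * (Real.exp η - 1) := abs_exp_sub_exp_le_of_abs_sub_le hzs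
  have hL0 : 0 ≤ (Real.sqrt (2 * t))⁻¹ := inv_nonneg.2 (Real.sqrt_nonneg _)
  have hc0 : 0 < Real.sqrt (2 * t₁) * Real.exp t₀ := by positivity
  have hsqrt : (Real.sqrt (2 * t))⁻¹ * (Real.exp t₀ * (Real.exp η - 1)) ≤
      (Real.exp η - 1) / Real.sqrt (2 * t₁) := by
    have hη : 0 ≤ Real.exp η - 1 := by
      have h := (abs_nonneg _).trans hzs
      linarith [Real.add_one_le_exp η]
    calc (Real.sqrt (2 * t))⁻¹ * (Real.exp t₀ * (Real.exp η - 1))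
        ≤ (Real.sqrt (2 * t₁) * Real.exp t₀)⁻¹ * (Real.exp t₀ * (Real.exp η - 1)) := by
          gcongr
          exact sqrt_mul_exp_le_sqrt ht₁ ht
      _ = (Real.exp η - 1) / Real.sqrt (2 * t₁) := by
          have h1 : Real.sqrt (2 * t₁) ≠ 0 := (Real.sqrt_pos.2 (by positivity)).ne'
          field_simp
  have hf := abs_gaussProfile_sub_le htpos ‖Φ z - y‖ ‖Real.exp t₀ • truncL z - y‖
  have h1 := (abs_sub_le_iff.1 hf).1
  have h2 : (Real.sqrt (2 * t))⁻¹ * |‖Φ z - y‖ - ‖Real.exp t₀ • truncL z - y‖| ≤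
      (Real.exp η - 1) / Real.sqrt (2 * t₁) := (mul_le_mul_of_nonneg_left hdiff hL0).trans hsqrt
  linarith

/-- **Step 2 integrated**: `∫_A w(Φ z) ≤ ∫_A w(e^{t₀} z') + K μHE⁴(A)`, `K = (e^{η} − 1)/√(2t₁)`,
for the Gaussian weight `w = gaussianWeight y t`. [folklore] -/
theorem setLIntegral_gaussianWeight_conformalMap_le
    {Φ : EuclideanSpace ℝ (Fin 6) → EuclideanSpace ℝ (Fin 5)}
    (hΦ : ∀ z, Φ z = Real.exp (z 5) • truncL z) {t₀ t₁ η t : ℝ} (ht₁ : 0 < t₁) (hη : 0 ≤ η)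
    (ht : t₁ * Real.exp (2 * t₀) ≤ t) {A : Set (EuclideanSpace ℝ (Fin 6))}
    (hA : A ⊆ {z : EuclideanSpace ℝ (Fin 6) | ∑ i : Fin 5, z (Fin.castSucc i) ^ 2 = 1})
    (hAm : MeasurableSet A) (hslab : ∀ z ∈ A, |z 5 - t₀| ≤ η) (y : EuclideanSpace ℝ (Fin 5)) :
    ∫⁻ z in A, gaussianWeight y t (Φ z) ∂(μHE[4] : Measure (EuclideanSpace ℝ (Fin 6))) ≤
      ∫⁻ z in A, gaussianWeight y t (Real.exp t₀ • truncL z)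
          ∂(μHE[4] : Measure (EuclideanSpace ℝ (Fin 6))) +
        ENNReal.ofReal ((Real.exp η - 1) / Real.sqrt (2 * t₁)) *
          (μHE[4] : Measure (EuclideanSpace ℝ (Fin 6))) A := by
  have hK0 : 0 ≤ (Real.exp η - 1) / Real.sqrt (2 * t₁) :=
    div_nonneg (sub_nonneg.2 (Real.one_le_exp hη)) (Real.sqrt_nonneg _)
  have hpt : ∀ z ∈ A, gaussianWeight y t (Φ z) ≤
      gaussianWeight y t (Real.exp t₀ • truncL z) +
        ENNReal.ofReal ((Real.exp η - 1) / Real.sqrt (2 * t₁)) := by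
    intro z hz
    unfold gaussianWeight
    rw [← ENNReal.ofReal_add (Real.exp_pos _).le hK0]
    exact ENNReal.ofReal_le_ofReal (gaussProfile_conformalMap_le hΦ ht₁ ht (hA hz) (hslab z hz) y)
  calc ∫⁻ z in A, gaussianWeight y t (Φ z) ∂(μHE[4] : Measure (EuclideanSpace ℝ (Fin 6)))
      ≤ ∫⁻ z in A, (gaussianWeight y t (Real.exp t₀ • truncL z) +
          ENNReal.ofReal ((Real.exp η - 1) / Real.sqrt (2 * t₁)))
            ∂(μHE[4] : Measure (EuclideanSpace ℝ (Fin 6))) := setLIntegral_mono' hAm hpt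
    _ = _ := by
        rw [lintegral_add_right _ measurable_const, setLIntegral_const]

/-! ## The core estimate -/

/-- **Core estimate** (steps 1–5 of the module docstring, before the choice of `η, ε`). For
`A ⊆ N` measurable whose shadow covers `S⁴`, in the slab `|z₅ − t₀| ≤ η`, with
`μHE⁴(A) ≤ (1+ε) μHE⁴(S⁴)`, and `t ≥ t₁ e^{2t₀}`:
`F_{y,t}(Φ A) ≤ e^{4η} λ(S⁴) + (4πt₁)⁻² e^{4η} (ε + K(1+ε)) μHE⁴(S⁴)`, `K = (e^{η} − 1)/√(2t₁)`.
[folklore] -/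
theorem gaussianArea_conformalMap_image_le_budget
    {Φ : EuclideanSpace ℝ (Fin 6) → EuclideanSpace ℝ (Fin 5)}
    (hΦ : ∀ z, Φ z = Real.exp (z 5) • truncL z) {t₀ t₁ η ε : ℝ} (ht₁ : 0 < t₁) (hη : 0 ≤ η)
    (hε : 0 ≤ ε) {A : Set (EuclideanSpace ℝ (Fin 6))}
    (hA : A ⊆ {z : EuclideanSpace ℝ (Fin 6) | ∑ i : Fin 5, z (Fin.castSucc i) ^ 2 = 1})
    (hAm : MeasurableSet A) (hcov : Metric.sphere (0 : EuclideanSpace ℝ (Fin 5)) 1 ⊆ truncL '' A)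
    (hslab : ∀ z ∈ A, |z 5 - t₀| ≤ η)
    (harea : (μHE[4] : Measure (EuclideanSpace ℝ (Fin 6))) A ≤
      ENNReal.ofReal (1 + ε) * (μHE[4] : Measure (EuclideanSpace ℝ (Fin 5))) (Metric.sphere 0 1))
    (y : EuclideanSpace ℝ (Fin 5)) {t : ℝ} (ht : t₁ * Real.exp (2 * t₀) ≤ t) :
    gaussianArea 4 y t (Φ '' A) ≤
      ENNReal.ofReal (Real.exp (4 * η)) *
          gaussianEntropy 4 (Metric.sphere (0 : EuclideanSpace ℝ (Fin 5)) 1) +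
        gaussianNormalization 4 t₁ * ENNReal.ofReal (Real.exp (4 * η)) *
          ((ENNReal.ofReal ε + ENNReal.ofReal ((Real.exp η - 1) / Real.sqrt (2 * t₁)) *
              ENNReal.ofReal (1 + ε)) *
            (μHE[4] : Measure (EuclideanSpace ℝ (Fin 5))) (Metric.sphere 0 1)) := by
  have htpos : 0 < t := lt_of_lt_of_le (by positivity) ht
  have hV := euclideanHausdorffMeasure_unitSphere_four_pos_lt_top
  have hgm : Measurable (gaussianWeight y t : EuclideanSpace ℝ (Fin 5) → ℝ≥0∞) :=
    measurable_gaussianWeight y t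
  have hg1 : ∀ w : EuclideanSpace ℝ (Fin 5), gaussianWeight y t w ≤ 1 :=
    gaussianWeight_le_one y htpos.le
  have hb : ∀ z ∈ A, z 5 ≤ t₀ + η := fun z hz => by
    have h := (abs_sub_le_iff.1 (hslab z hz)).1
    linarith
  -- Step 1: push-forward
  have h1 := setLIntegral_conformalMap_image_le hΦ hA hb hgm
  -- Step 2: move to the slice
  have h2 := setLIntegral_gaussianWeight_conformalMap_le hΦ ht₁ hη ht hA hAm hslab y
  -- Step 3: shadow
  have h3 : ∫⁻ z in A, gaussianWeight y t (Real.exp t₀ • truncL z)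
        ∂(μHE[4] : Measure (EuclideanSpace ℝ (Fin 6))) ≤
      ∫⁻ x in Metric.sphere (0 : EuclideanSpace ℝ (Fin 5)) 1, gaussianWeight y t (Real.exp t₀ • x)
          ∂(μHE[4] : Measure (EuclideanSpace ℝ (Fin 5))) +
        ((μHE[4] : Measure (EuclideanSpace ℝ (Fin 6))) A -
          (μHE[4] : Measure (EuclideanSpace ℝ (Fin 5))) (Metric.sphere 0 1)) :=
    setLIntegral_comp_truncL_le hcov (G := fun x => gaussianWeight y t (Real.exp t₀ • x))
      (hgm.comp (measurable_const_smul (Real.exp t₀))) (fun x => hg1 _)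
  -- Step 4: main term, and bookkeeping
  have h4 := gaussianNormalization_mul_setLIntegral_smul_le y htpos t₀
  have h5 := gaussianNormalization_mul_exp_le ht₁ ht
  have h6 : (μHE[4] : Measure (EuclideanSpace ℝ (Fin 6))) A -
      (μHE[4] : Measure (EuclideanSpace ℝ (Fin 5))) (Metric.sphere 0 1) ≤
        ENNReal.ofReal ε * (μHE[4] : Measure (EuclideanSpace ℝ (Fin 5))) (Metric.sphere 0 1) := by
    rw [tsub_le_iff_right]
    calc (μHE[4] : Measure (EuclideanSpace ℝ (Fin 6))) A
        ≤ ENNReal.ofReal (1 + ε) * (μHE[4] : Measure (EuclideanSpace ℝ (Fin 5))) (Metric.sphere 0 1) :=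
          harea
      _ = _ := by
          rw [ENNReal.ofReal_add zero_le_one hε, ENNReal.ofReal_one, add_mul, one_mul, add_comm]
  have hsplit : ENNReal.ofReal (Real.exp (4 * (t₀ + η))) =
      ENNReal.ofReal (Real.exp (4 * t₀)) * ENNReal.ofReal (Real.exp (4 * η)) := by
    rw [← ENNReal.ofReal_mul (Real.exp_pos _).le, ← Real.exp_add]
    ring_nf
  calc gaussianArea 4 y t (Φ '' A)
      = gaussianNormalization 4 t * ∫⁻ w in Φ '' A, gaussianWeight y t w
          ∂(μHE[4] : Measure (EuclideanSpace ℝ (Fin 5))) := gaussianArea_eq 4 y t _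
    _ ≤ gaussianNormalization 4 t * (ENNReal.ofReal (Real.exp (4 * (t₀ + η))) *
          (∫⁻ x in Metric.sphere (0 : EuclideanSpace ℝ (Fin 5)) 1,
              gaussianWeight y t (Real.exp t₀ • x) ∂(μHE[4] : Measure (EuclideanSpace ℝ (Fin 5))) +
            ((μHE[4] : Measure (EuclideanSpace ℝ (Fin 6))) A -
              (μHE[4] : Measure (EuclideanSpace ℝ (Fin 5))) (Metric.sphere 0 1)) +
            ENNReal.ofReal ((Real.exp η - 1) / Real.sqrt (2 * t₁)) *
              (μHE[4] : Measure (EuclideanSpace ℝ (Fin 6))) A)) := by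
        gcongr
        refine h1.trans ?_
        gcongr
        exact h2.trans (add_le_add h3 le_rfl)
    _ = ENNReal.ofReal (Real.exp (4 * η)) * (gaussianNormalization 4 t *
          (ENNReal.ofReal (Real.exp (4 * t₀)) *
            ∫⁻ x in Metric.sphere (0 : EuclideanSpace ℝ (Fin 5)) 1,
              gaussianWeight y t (Real.exp t₀ • x) ∂(μHE[4] : Measure (EuclideanSpace ℝ (Fin 5))))) +
        gaussianNormalization 4 t * ENNReal.ofReal (Real.exp (4 * t₀)) *
          ENNReal.ofReal (Real.exp (4 * η)) *
          (((μHE[4] : Measure (EuclideanSpace ℝ (Fin 6))) A -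
              (μHE[4] : Measure (EuclideanSpace ℝ (Fin 5))) (Metric.sphere 0 1)) +
            ENNReal.ofReal ((Real.exp η - 1) / Real.sqrt (2 * t₁)) *
              (μHE[4] : Measure (EuclideanSpace ℝ (Fin 6))) A) := by
        rw [hsplit]
        ring
    _ ≤ ENNReal.ofReal (Real.exp (4 * η)) *
          gaussianEntropy 4 (Metric.sphere (0 : EuclideanSpace ℝ (Fin 5)) 1) +
        gaussianNormalization 4 t₁ * ENNReal.ofReal (Real.exp (4 * η)) *
          (ENNReal.ofReal ε * (μHE[4] : Measure (EuclideanSpace ℝ (Fin 5))) (Metric.sphere 0 1) +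
            ENNReal.ofReal ((Real.exp η - 1) / Real.sqrt (2 * t₁)) *
              (ENNReal.ofReal (1 + ε) *
                (μHE[4] : Measure (EuclideanSpace ℝ (Fin 5))) (Metric.sphere 0 1))) :=
        add_le_add (mul_le_mul' le_rfl h4)
          (mul_le_mul' (mul_le_mul' h5 le_rfl) (add_le_add h6 (mul_le_mul' le_rfl harea)))
    _ = _ := by ring

/-! ## The choice of `η = ε = θ` -/

/-- The budget in real form: `ofReal`-arithmetic. [folklore] -/
theorem ofReal_budget_eq {a l n e k e₁ v : ℝ} (ha : 0 ≤ a) (hl : 0 ≤ l) (hn : 0 ≤ n) (he : 0 ≤ e)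
    (hk : 0 ≤ k) (he₁ : 0 ≤ e₁) (hv : 0 ≤ v) :
    ENNReal.ofReal a * ENNReal.ofReal l +
        ENNReal.ofReal n * ENNReal.ofReal a *
          ((ENNReal.ofReal e + ENNReal.ofReal k * ENNReal.ofReal e₁) * ENNReal.ofReal v) =
      ENNReal.ofReal (a * l + n * a * ((e + k * e₁) * v)) := by
  rw [ENNReal.ofReal_add (by positivity) (by positivity), ENNReal.ofReal_mul ha,
    ENNReal.ofReal_mul (p := n * a) (by positivity), ENNReal.ofReal_mul hn,
    ENNReal.ofReal_mul (p := e + k * e₁) (by positivity), ENNReal.ofReal_add he (by positivity),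
    ENNReal.ofReal_mul hk]

/-- **Existence of a small parameter.** The real budget
`θ ↦ e^{4θ} Λ + n e^{4θ} ((θ + (e^{θ} − 1)/√(2t₁) · (1 + θ)) V)` is continuous with value `Λ` at
`θ = 0`, so it is `< Λ + δ` at some `θ > 0`. [folklore] -/
theorem exists_budget_lt (Λ n V t₁ : ℝ) {δ : ℝ} (hδ : 0 < δ) :
    ∃ θ : ℝ, 0 < θ ∧
      Real.exp (4 * θ) * Λ + n * Real.exp (4 * θ) *
          ((θ + (Real.exp θ - 1) / Real.sqrt (2 * t₁) * (1 + θ)) * V) < Λ + δ := by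
  have hcont : ContinuousAt (fun θ : ℝ => Real.exp (4 * θ) * Λ + n * Real.exp (4 * θ) *
      ((θ + (Real.exp θ - 1) / Real.sqrt (2 * t₁) * (1 + θ)) * V)) 0 := by
    fun_prop
  have h0 : Real.exp (4 * 0) * Λ + n * Real.exp (4 * 0) *
      ((0 + (Real.exp 0 - 1) / Real.sqrt (2 * t₁) * (1 + 0)) * V) = Λ := by
    simp
  have hev := hcont.tendsto.eventually_lt_const (u := Λ + δ) (by rw [h0]; linarith)
  obtain ⟨r, hr, hball⟩ := Metric.eventually_nhds_iff.1 hev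
  refine ⟨r / 2, by positivity, hball ?_⟩
  rw [Real.dist_eq, sub_zero, abs_of_pos (by positivity)]
  linarith

/-! ## The registered stub -/

/-- **STUB 4 · GROUND-STATE CONTINUITY** of line `conformal-kernel-domination` (crux
`CylinderEntropy.SliceIsolation`): for every `δ > 0` and `t₁ > 0` there are `η > 0`, `ε > 0` such
that for every measurable end-separating `A ⊆ N` in the slab of half-height `η` around `t₀` with
`μH⁴(A) ≤ (1+ε) μH⁴(S⁴)`, every centre `y` and every scale `t ≥ t₁ e^{2t₀}`, the Euclidean Gaussian
area of `Φ(A)` is at most `λ(unit S⁴) + δ`. [folklore] -/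
theorem stub_groundStateContinuity :
    ∀ δ : ℝ, 0 < δ → ∀ t₁ : ℝ, 0 < t₁ → ∃ η : ℝ, 0 < η ∧ ∃ ε : ℝ, 0 < ε ∧
      ∀ (t₀ : ℝ) (A : Set (EuclideanSpace ℝ (Fin 6))),
        A ⊆ {z : EuclideanSpace ℝ (Fin 6) | ∑ i : Fin 5, z (Fin.castSucc i) ^ 2 = 1} → MeasurableSet A →
        (∃ R : ℝ, ∀ a b : EuclideanSpace ℝ (Fin 6), ∑ i : Fin 5, a (Fin.castSucc i) ^ 2 = 1 →
          ∑ i : Fin 5, b (Fin.castSucc i) ^ 2 = 1 → a 5 ≤ -R → R ≤ b 5 →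
          ¬ JoinedIn ({z : EuclideanSpace ℝ (Fin 6) | ∑ i : Fin 5, z (Fin.castSucc i) ^ 2 = 1} \ A) a b) →
        (∀ z ∈ A, |z 5 - t₀| ≤ η) →
        μH[4] A ≤ ENNReal.ofReal (1 + ε) * μH[4] (Metric.sphere (0 : EuclideanSpace ℝ (Fin 5)) 1) →
        ∀ (y : EuclideanSpace ℝ (Fin 5)) (t : ℝ), t₁ * Real.exp (2 * t₀) ≤ t →
          gaussianArea 4 y t
            ((fun z : EuclideanSpace ℝ (Fin 6) =>
          (WithLp.toLp 2 (fun i : Fin 5 => Real.exp (z 5) * z (Fin.castSucc i)) : EuclideanSpace ℝ (Fin 5))) '' A) ≤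
            gaussianEntropy 4 (Metric.sphere (0 : EuclideanSpace ℝ (Fin 5)) 1) + ENNReal.ofReal δ := by
  intro δ hδ t₁ ht₁
  have hV := euclideanHausdorffMeasure_unitSphere_four_pos_lt_top
  obtain ⟨θ, hθ, hbudget⟩ := exists_budget_lt (32 / (3 * Real.exp 1 ^ 2)) (((4 * Real.pi * t₁) ^ 2)⁻¹)
    ((μHE[4] : Measure (EuclideanSpace ℝ (Fin 5))) (Metric.sphere 0 1)).toReal t₁ hδ
  refine ⟨θ, hθ, θ, hθ, ?_⟩
  intro t₀ A hA hAm hsep hslab harea y t ht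
  obtain ⟨R, hR⟩ := hsep
  have hcov := sphere_subset_image_truncL hR
  have harea' := euclideanHausdorffMeasure_le_of_hausdorffMeasure_le harea
  have hcore := gaussianArea_conformalMap_image_le_budget
    (Φ := fun z : EuclideanSpace ℝ (Fin 6) =>
      (WithLp.toLp 2 (fun i : Fin 5 => Real.exp (z 5) * z (Fin.castSucc i)) :
        EuclideanSpace ℝ (Fin 5)))
    conformalMap_apply_eq_smul ht₁ hθ.le hθ.le hA hAm hcov hslab harea' y ht
  have hK0 : 0 ≤ (Real.exp θ - 1) / Real.sqrt (2 * t₁) :=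
    div_nonneg (sub_nonneg.2 (Real.one_le_exp hθ.le)) (Real.sqrt_nonneg _)
  refine hcore.trans ?_
  rw [gaussianEntropy_unitSphere_four, gaussianNormalization_four ht₁,
    ← ENNReal.ofReal_toReal hV.2.ne,
    ofReal_budget_eq (Real.exp_pos _).le (by positivity) (by positivity) hθ.le hK0 (by positivity)
      ENNReal.toReal_nonneg,
    ← ENNReal.ofReal_add (by positivity) hδ.le]
  exact ENNReal.ofReal_le_ofReal hbudget.le

end Summit.SmoothPoincare4.SmoothPoincare4.Theorems.CylinderEntropySliceIsolation
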